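import Literature.Topology.FourManifolds.TracePolarTrace
import HarnessLib

/-!
# Rigidity of a boundary map at a saddle, in flow-polar coordinates

Topic `Literature/Topology/FourManifolds` (support file for the Torelli half of Griffiths'
handlebody theorem, `stmt-SmoothPoincare4-15190`, after `TracePolarTrace.lean`).
Everything here is **proved**; no definitions.

`PairSaddleRigid.lean` formulates the hypothesis of the two-field endgame theorem
(`PairEndgame.lean`) at a saddle `s` as `SaddleData.Rigid χ s δ`: on the exit annulus of `s`
the transport of `χ` to the level `L` is the model conjugation `MC s` followed by the
`ξ_B`-flow.  In the flow-polar charts of `TracePolarChart.lean` — `Q.pol s` about the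
`ξ_A`-trace of `s` and `Q.swap.pol (σ s)` about the `ξ_B`-trace of `σ s` — this says exactly that
**`χ` is the identity in coordinates**:

* `SaddleData.rigid_of_pol_eq` — if `χ (Q.pol s w) = Q.swap.pol (Q.σ s) w` for all `w ≠ 0` with
  `x₁(w)² < δ` (`δ ≤ ε²`), then `Q.Rigid χ s δ`;
* `SaddleData.pol_eq_of_rigid` — the converse;
* `SaddleData.MC_polW` — the model conjugation carries the flow-polar point of `s` to the
  flow-polar point of `σ s` with the same coordinates.

So a boundary diffeomorphism which, about every trace circle, is *the identity in flow-polar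
coordinates* (for suitably twisted boxes at the image saddles) extends over `W`
(`PairEndgame.lean`); the straightening of an arbitrary diffeomorphism permuting the trace
circles to this form is the business of the sequel.

## References

* H. B. Griffiths, *Automorphisms of a 3-dimensional handlebody*, Abh. Math. Sem. Univ. Hamburg
  26 (1964), §§3–6. [GriffithsHB1964Handlebody]
* J. Milnor, *Lectures on the h-cobordism theorem* (1965), proofs of Thms. 3.12–3.13, Thm. 4.1
  (PDF pp. 17–22). [MilnorHCobordism1965]
-/

open scoped Manifold ContDiff Topology
open Set Function Filter Metric

noncomputable section

namespace Literature.Topology.FourManifolds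

open Cobordism FourManifolds.Flow TracePolar

universe u

namespace BasinPair

namespace SaddleData

variable {W : Type u} [TopologicalSpace W] [T2Space W] [SecondCountableTopology W]
  [CompactSpace W] [ChartedSpace (EuclideanHalfSpace (2 + 1)) W] [IsManifold (𝓡∂ (2 + 1)) ∞ W]
  {g : W → ℝ} {ξA ξB : Π x : W, TangentSpace (𝓡∂ (2 + 1)) x} {P : BasinPair g ξA ξB}
  {Q : P.SaddleData}

/-- Local notation for the model plane. -/
local notation "E2" => EuclideanSpace ℝ (Fin 2)

/-! ### The model conjugation in flow-polar coordinates -/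

/-- The swapped data have the same exit level. [folklore] -/
@[simp] theorem swap_exitLevel (Q : P.SaddleData) : Q.swap.exitLevel = Q.exitLevel := rfl

/-- The swapped data have the same flow-polar target. [folklore] -/
@[simp] theorem swap_polTarget (Q : P.SaddleData) : Q.swap.polTarget = Q.polTarget := rfl

/-- **The model conjugation carries the flow-polar point of `s` with coordinates `w` to the
flow-polar point of `σ s` with the same coordinates.** [cite: MilnorHCobordism1965, proof of Thm. 3.13 (PDF pp. 18–19)] -/
theorem MC_polW {s : SaddlePt 2 g} {w : E2} (hw : w ∈ Q.polTarget) : Q.MC s (Q.polW s w) = Q.swap.polW (Q.σ s) w := by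
  rw [MC_def, MilnorBox.chartMap, (polW_mem_chartBall hw).2]
  rfl

/-- A point of the exit set of width `δ ≤ ε²` on the exit level is the flow-polar point of its
flow-polar coordinates, which are admissible. [folklore] -/
theorem exists_eq_polW_of_mem_Uexit {s : SaddlePt 2 g} (hk : (Q.DA s).k = 1) {δ : ℝ} (hδ : δ ≤ Q.ε ^ 2) {z : W}
    (hz : z ∈ Q.Uexit s δ) (hzℓ : g z = Q.c + Q.ε ^ 2) :
    ∃ w : E2, w ∈ Q.polTarget ∧ xco Q.ε w ^ 2 < δ ∧ Q.polW s w = z := by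
  set u := (Q.DA s).coord z with hu
  have hsh : milnorQuadratic 1 u = Q.ε ^ 2 := by
    have h := Q.apply_eq_of_mem_chartBall hz.1
    rw [hzℓ, hk] at h; linarith
  have hx : xco Q.ε (polarOut Q.ε u) ^ 2 < δ := by
    rw [xco_polarOut Q.ε_pos hsh, ← sqSumLT_one]
    have h := hz.2; rw [hk] at h; exact h
  refine ⟨polarOut Q.ε u, ⟨polarOut_ne_zero Q.ε_pos hsh, hx.trans_le hδ⟩, hx, ?_⟩
  rw [polW, hypPoint_polarOut Q.ε_pos hsh]
  exact (Q.DA s).symm_add_coord_of_mem_chartBall hz.1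

variable [Nonempty (BoundaryManifold.boundaryData 2 W).carrier]
  {χ : (𝓡∂ (2 + 1)).boundary W → (𝓡∂ (2 + 1)).boundary W}

/-- `push_A` of the flow-polar boundary point is the top of the flow-polar point. [folklore] -/
theorem push_pol {s : SaddlePt 2 g} (hk : (Q.DA s).k = 1) {w : E2} (hw : w ∈ Q.polTarget) :
    P.A.push (Q.pol s w : W) = P.A.top (Q.polW s w) := by
  have hL : g (P.A.top (Q.polW s w)) = P.A.L := P.A.apply_top (hits_L_polW hk hw)
  rw [pol, P.A.coe_bret (by rw [hL]; exact P.A.one_sub_a'_lt_L.le), P.A.push_ret_of_apply_eq_L hL]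

/-- **The transport of `χ` at the top of a flow-polar point, in flow-polar coordinates.** [folklore] -/
theorem transportAB_top_polW {s : SaddlePt 2 g} (hk : (Q.DA s).k = 1) {w : E2} (hw : w ∈ Q.polTarget) :
    P.transportAB χ (P.A.top (Q.polW s w)) = P.B.push (χ (Q.pol s w) : W) := by
  rw [← push_pol hk hw, P.transportAB_push_coe]

omit [Nonempty (BoundaryManifold.boundaryData 2 W).carrier] in
/-- The index of the box of `σ s` is `1` when that of `s` is. [folklore] -/
theorem k_DB_eq_one {s : SaddlePt 2 g} (hk : (Q.DA s).k = 1) : (Q.swap.DA (Q.σ s)).k = 1 := by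
  show (Q.DB (Q.σ s)).k = 1
  rw [Q.k_eq]; exact hk

/-- **Rigidity from the flow-polar equation.**  If `χ ∘ pol_s = pol'_{σ s}` on
`{w ≠ 0, x₁(w)² < δ}` (`δ ≤ ε²`), where `pol'` is the flow-polar chart of the swapped data,
then `χ` is rigid at `s` with width `δ`. [cite: GriffithsHB1964Handlebody, §§3–6] [cite: MilnorHCobordism1965, proof of Thm. 3.13] -/
theorem rigid_of_pol_eq {s : SaddlePt 2 g} (hk : (Q.DA s).k = 1) {δ : ℝ} (hδ : δ ≤ Q.ε ^ 2)
    (h : ∀ w : E2, w ≠ 0 → xco Q.ε w ^ 2 < δ → χ (Q.pol s w) = Q.swap.pol (Q.σ s) w) :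
    Q.Rigid χ s δ := by
  intro z hz hzℓ
  obtain ⟨w, hw, hx, rfl⟩ := exists_eq_polW_of_mem_Uexit hk hδ hz hzℓ
  have hk' := k_DB_eq_one hk
  have hw' : w ∈ Q.swap.polTarget := hw
  rw [transportAB_top_polW hk hw, h w hw.1 hx, MC_polW hw]
  exact push_pol (Q := Q.swap) hk' hw'

/-- **The flow-polar equation from rigidity**: conversely, if `χ` is rigid at `s` with width
`δ ≤ ε²`, then `χ (pol_s w) = pol'_{σ s} w` for `w ≠ 0` with `x₁(w)² < δ`. [cite: GriffithsHB1964Handlebody, §§3–6] -/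
theorem pol_eq_of_rigid {s : SaddlePt 2 g} (hk : (Q.DA s).k = 1) {δ : ℝ} (hδ : δ ≤ Q.ε ^ 2)
    (hR : Q.Rigid χ s δ) {w : E2} (hw0 : w ≠ 0) (hx : xco Q.ε w ^ 2 < δ) :
    χ (Q.pol s w) = Q.swap.pol (Q.σ s) w := by
  have hw : w ∈ Q.polTarget := ⟨hw0, hx.trans_le hδ⟩
  have hk' := k_DB_eq_one hk
  have hw' : w ∈ Q.swap.polTarget := hw
  have hzU : Q.polW s w ∈ Q.Uexit s δ := by
    obtain ⟨hb, hc⟩ := polW_mem_chartBall (Q := Q) (s := s) hw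
    exact ⟨hb, by rw [hc, hk, sqSumLT_hypPoint]; exact hx⟩
  have h1 := hR _ hzU (apply_polW hk hw)
  have h2 : P.B.push (Q.swap.pol (Q.σ s) w : W) = P.B.top (Q.swap.polW (Q.σ s) w) :=
    push_pol (Q := Q.swap) hk' hw'
  rw [transportAB_top_polW hk hw, MC_polW hw, ← h2] at h1
  exact Subtype.ext (P.B.injective_push h1)

end SaddleData

end BasinPair

end Literature.Topology.FourManifolds
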